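import Literature.AlgebraicGeometry.Frobenioids.EquivalencePreStepsFSMType
import HarnessLib

/-!
# Frobenioids I, Theorem 3.4 (ii), pre-steps: the isotropic core over bases of FSMFF-type AS
# PRINTED (2008), including non-perfect Frobenioids

Mochizuki, *The geometry of Frobenioids I: the general theory*, Kyushu J. Math. **62** (2008)
293–400, Thm. 3.4 (ii), kurims p. 62 [cite: MochizukiFrdI2008, Thm. 3.4 (ii) p.62]:

> "(ii) Suppose that `C₁`, `C₂` are of quasi-isotropic type, and that `D₁`, `D₂` are of
> FSMFF-type. Then `Ψ` preserves pre-steps, co-angular pre-steps, and group-like objects."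

with "FSMFF-type" in the PRINTED 2008 sense (`IsOfFSMFFType`: (a) non-invertible FSM-morphisms
factor into FSMI-morphisms, (b) FSMI-chains out of each object have bounded length). The printed
route (p. 63, through Prop. 1.14 (ii), (iii)) is not available over such bases (the "⟸" of
Prop. 1.14 (iii) fails as printed; cell record PR-1); the author's 2024 revision of condition (b)
repairs it (`EquivalencePreStepsFSMFF2024.lean`, seat abc-iut-L1-t11), and bases of FSMFF-type in the
printed sense that are not of FSMFF-type in the revised sense exist (`FSMFFType2008Broom.lean`).

PROOF-ONLY file (seat abc-iut-L1-t13, the cell's discharger of record of Thm. 3.4; no definitions).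
It supplies the ISOTROPIC CORE of Thm. 3.4 (ii) over bases of FSMFF-type AS PRINTED, by an argument
that is not the printed one:

* `FrdI.isPreStep_map_of_isIrreducible_of_isOfFSMFFType`: for Frobenioids `C₁`, `C₂` of isotropic
  type, `D₂` of FSMFF-type (2008) — `D₁` arbitrary — and an equivalence `Ψ : C₁ ⥲ C₂`, `Ψ` maps
  every IRREDUCIBLE pre-step of `C₁` to a pre-step of `C₂`;
* `FrdI.not_isPreStep_inverse_map_of_isIrreducibleHom_of_isOfFSMFFType`: hence `Ψ⁻¹` carries
  irreducible non-pre-steps of `C₂` to non-pre-steps of `C₁` — the 2008 twin of the one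
  2024-dependent input of `EquivalencePreStepsFSMFF2024.lean` (l. 174), so that the assembly of
  the full statement (all pre-steps via Prop. 1.14 (ii), co-angular pre-steps, group-like objects,
  the quasi-isotropic reduction of p. 63 and the typed `PreFrobenioidData.Thm34ii`) runs verbatim
  with `IsOfFSMFFType2024` replaced by `IsOfFSMFFType` (seat abc-iut-L1-t11, companion file).

THE ARGUMENT. Suppose `σ : A → B` is an irreducible pre-step of `C₁` with `Ψσ` not a pre-step.
By Prop. 1.14 (i) in `C₂` and `FrdI.not_isPrimeFrobenius_map_of_isStep` (this lineage,
`EquivalenceStepPrimeFrobenius.lean`), `Ψσ` is a pull-back morphism with irreducible base.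
(W1) For `X ∈ Ob(C₁)` and a prime `p`, the Frobenius degree of `Ψ(π)` for `π` a morphism of
Frobenius type of degree `p` out of `X` is constant along pre-steps `X → Y` (Frobenius conjugates,
Prop. 1.10 (i), and `FrdI.isLinear_map_of_isPreStep`: `Ψ` maps pre-steps to linear morphisms).
(W2) At `A` this degree is `1`: otherwise `Ψπ_A`, `Ψπ_B` are of Frobenius type and the Frobenius
conjugate `t` of `σ` — a pre-step with `Div(t) = p · Div(σ)`, hence REDUCIBLE — has `Ψt` = the
Frobenius conjugate of the pull-back `Ψσ`, a pull-back with irreducible base, hence irreducible.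
(W3) Let `O` be a Frobenius-trivial object over `Base(A)` (Def. 1.3 (i)(a)), joined to `A` by a span
of pre-steps (Def. 1.3 (i)(b)); by (W1), (W2) and `FrdI.not_isStep_map_of_isPrimeFrobenius`, `Ψ`
maps the Frobenius endomorphism `ζ_p` of `O` to a linear pull-back ENDOMORPHISM (`Div = 0`).
(W4) Let `σ₀ : O → O₁` be a step with irreducible divisor `x'` (the transport of `Div σ`), `c_p :
O → O_p` the co-angular pre-step with divisor `p·x'`, `σ₀ ≫ τ = c_p` (Def. 1.3 (iii)(d)); the
Frobenius conjugate of `σ₀` by `ζ_p` factors through `c_p`, and reading `Div` in `C₂` of the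
resulting identity `ζ_p ≫ σ₀ ≫ τ ≫ e = σ₀ ≫ π₁` gives `Div(Ψσ₀) = g^*(… · Div(Ψσ₀))` with
`g = Base(Ψζ_p)`; whether `Div(Ψσ₀)` is trivial or irreducible, this forces `Ψτ` to be an
ISOMETRY. But `τ` is a composite of `p − 1` non-invertible pre-steps whose images are then linear
isometries, i.e. pull-back FSM-morphisms with non-invertible FSM bases: by (a) an FSMI-chain of
length `≥ p − 1` out of `Base(Ψ O₁)`, for every prime `p` — contradicting (b) at that one object.
Only conditions (a), (b) of `D₂` (2008) and isotropy are used. No statement of the paper is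
restated or strengthened; nothing here bears on [IUTchIII].
-/

set_option backward.isDefEq.respectTransparency false

namespace Literature.AlgebraicGeometry.Frobenioids

open CategoryTheory Opposite

universe w v v' u u'

/-! ### Concatenation of chains of FSMI-morphisms -/

/-- A chain of `m` FSMI-morphisms followed by a chain of `k` FSMI-morphisms is a chain of `k + m`
FSMI-morphisms. [cite: MochizukiFrdI2008, §0 p.17] -/
private theorem IsFSMIChain.concat {C : Type u} [Category.{v} C] {X Y Z : C} {ψ : X ⟶ Y}
    {χ : Y ⟶ Z} {m k : ℕ} (hψ : IsFSMIChain ψ m) (hχ : IsFSMIChain χ k) :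
    IsFSMIChain (ψ ≫ χ) (k + m) := by
  induction hψ generalizing Z with
  | single ψ h => exact IsFSMIChain.cons ψ χ k h hχ
  | cons ψ₁ ψ₂ n h₁ _ ih =>
    rw [Category.assoc]
    exact IsFSMIChain.cons ψ₁ (ψ₂ ≫ χ) (k + n) h₁ (ih hχ)

namespace FrdI

/-! ### One Frobenioid of isotropic type -/

section One

variable {D : Type u} [Category.{v} D] {Φ : Dᵒᵖ ⥤ CommMonCat.{w}} {C : Type u'} [Category.{v'} C]
  {F : C ⥤ ElemFrobenioid Φ}

/-- In a Frobenioid of isotropic type a linear isometry is a pull-back morphism (Prop. 1.4 (i), (ii):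
every morphism is co-angular; a pull-back morphism is an LB-invertible linear morphism).
[cite: MochizukiFrdI2008, Prop. 1.4 (ii) p.26] -/
theorem isPullbackMorphism_of_isLinear_of_isIsometry (hF : PreFrobenioid.IsFrobenioid F)
    (hi : ∀ A : C, PreFrobenioid.IsIsotropic F A) {A B : C} {φ : A ⟶ B}
    (hl : PreFrobenioid.IsLinear F φ) (hm : PreFrobenioid.IsIsometry F φ) :
    PreFrobenioid.IsPullbackMorphism F φ :=
  (PreFrobenioid.isPullbackMorphism_iff_isLBInvertible_isLinear F hF φ).2
    ⟨⟨PreFrobenioid.isCoAngular_of_isIsotropic_codomains F φ (fun Z _ => hi Z), hm⟩, hl⟩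

end One

/-! ### Two Frobenioids of isotropic type and an equivalence -/

section Two

variable {D₁ : Type u} [Category.{v} D₁] {Φ₁ : D₁ᵒᵖ ⥤ CommMonCat.{w}} {C₁ : Type u'}
  [Category.{v'} C₁] {D₂ : Type u} [Category.{v} D₂] {Φ₂ : D₂ᵒᵖ ⥤ CommMonCat.{w}} {C₂ : Type u'}
  [Category.{v'} C₂] {F₁ : C₁ ⥤ ElemFrobenioid Φ₁} {F₂ : C₂ ⥤ ElemFrobenioid Φ₂}

/-- **(W1)** The Frobenius degree of `Ψ(π)`, `π` of Frobenius type of a fixed degree, is constant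
along pre-steps: if `φ : X → Y` is a pre-step and `π_X`, `π_Y` are of Frobenius type of the same
degree out of `X`, `Y`, then `deg_Fr Ψ(π_X) = deg_Fr Ψ(π_Y)` (Frobenius conjugate `π_X ≫ t = φ ≫ π_Y`
of Prop. 1.10 (i); `Ψt`, `Ψφ` are linear). [cite: MochizukiFrdI2008, Prop. 1.10 (i) p.34] -/
theorem degFr_map_frobenius_eq_of_isPreStep (hF₁ : PreFrobenioid.IsFrobenioid F₁)
    (hF₂ : PreFrobenioid.IsFrobenioid F₂) (hi₁ : ∀ A : C₁, PreFrobenioid.IsIsotropic F₁ A)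
    (hi₂ : ∀ A : C₂, PreFrobenioid.IsIsotropic F₂ A) (Ψ : C₁ ≌ C₂) {X Y X' Y' : C₁} {φ : X ⟶ Y}
    (hφ : PreFrobenioid.IsPreStep F₁ φ) {πX : X ⟶ X'} {πY : Y ⟶ Y'}
    (hπX : PreFrobenioid.IsFrobeniusType F₁ πX) (hπY : PreFrobenioid.IsFrobeniusType F₁ πY)
    (hd : PreFrobenioid.degFr F₁ πX = PreFrobenioid.degFr F₁ πY) :
    PreFrobenioid.degFr F₂ (Ψ.functor.map πX) = PreFrobenioid.degFr F₂ (Ψ.functor.map πY) := by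
  obtain ⟨t, ht, -⟩ := PreFrobenioid.existsUnique_frobeniusConjugate hF₁ φ hπX hπY hd
  have htp : PreFrobenioid.IsPreStep F₁ t := hφ.frobeniusConjugate hF₁ ht hπX hπY hd
  have h1 : PreFrobenioid.degFr F₂ (Ψ.functor.map t) = 1 := isLinear_map_of_isPreStep hF₁ hF₂ hi₁ hi₂ Ψ htp
  have h2 : PreFrobenioid.degFr F₂ (Ψ.functor.map φ) = 1 := isLinear_map_of_isPreStep hF₁ hF₂ hi₁ hi₂ Ψ hφ
  have h := congrArg (fun f => PreFrobenioid.degFr F₂ (Ψ.functor.map f)) ht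
  simp only [Functor.map_comp, PreFrobenioid.degFr_comp, h1, h2, mul_one, one_mul] at h
  exact h

/-- A prime-Frobenius morphism `π` of `C₁` whose image has Frobenius degree `1` is mapped by `Ψ` to
a pull-back morphism with irreducible base (Prop. 1.14 (i) in `C₂`: `Ψπ` is irreducible, not
prime-Frobenius by degree, not a step by `FrdI.not_isStep_map_of_isPrimeFrobenius`).
[cite: MochizukiFrdI2008, Prop. 1.14 (i) p.41] -/
theorem isPullbackMorphism_map_of_isPrimeFrobenius_of_degFr_eq_one
    (hF₁ : PreFrobenioid.IsFrobenioid F₁) (hF₂ : PreFrobenioid.IsFrobenioid F₂)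
    (hi₁ : ∀ A : C₁, PreFrobenioid.IsIsotropic F₁ A) (hi₂ : ∀ A : C₂, PreFrobenioid.IsIsotropic F₂ A)
    (Ψ : C₁ ≌ C₂) {A B : C₁} {π : A ⟶ B} (hπ : PreFrobenioid.IsPrimeFrobenius F₁ π)
    (h1 : PreFrobenioid.degFr F₂ (Ψ.functor.map π) = 1) :
    PreFrobenioid.IsPullbackMorphism F₂ (Ψ.functor.map π) ∧
      IsIrreducibleHom (PreFrobenioid.Base F₂ (Ψ.functor.map π)) := by
  have hirr : IsIrreducibleHom (Ψ.functor.map π) := (hπ.isIrreducibleHom hF₁ (hi₁ _)).map_equivalence Ψ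
  rcases PreFrobenioid.trichotomy_of_isIrreducibleHom F₂ hF₂ hi₂ hirr with h | ⟨hstep, -⟩ | h
  · have h2 := h.2
    rw [h1, PNat.one_coe] at h2
    exact (Nat.not_prime_one h2).elim
  · exact (not_isStep_map_of_isPrimeFrobenius hF₁ hF₂ hi₁ hi₂ Ψ hπ hstep).elim
  · exact h

/-- **(W2)** If an irreducible pre-step `σ : A → B` of `C₁` is mapped by `Ψ` to a pull-back morphism,
then every prime-Frobenius morphism out of `A` is mapped to a morphism of Frobenius degree `1`.
(Otherwise `Ψπ_A` and its partner `Ψπ_B` are of Frobenius type, and the Frobenius conjugate `t` of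
`σ` — a pre-step of divisor `p · Div(σ)`, reducible by Def. 1.3 (iii)(d) — is mapped to the Frobenius
conjugate of the pull-back `Ψσ`, a pull-back with irreducible base, which is irreducible by
Prop. 1.11 (vi).) [cite: MochizukiFrdI2008, Thm. 3.4 (ii) p.62] -/
theorem degFr_map_eq_one_of_isPullbackMorphism_map (hF₁ : PreFrobenioid.IsFrobenioid F₁)
    (hF₂ : PreFrobenioid.IsFrobenioid F₂) (hi₁ : ∀ A : C₁, PreFrobenioid.IsIsotropic F₁ A)
    (hi₂ : ∀ A : C₂, PreFrobenioid.IsIsotropic F₂ A) (Ψ : C₁ ≌ C₂) {A B : C₁} {σ : A ⟶ B}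
    (hσ : PreFrobenioid.IsPreStep F₁ σ) (hirr : IsIrreducibleHom σ)
    (hpb : PreFrobenioid.IsPullbackMorphism F₂ (Ψ.functor.map σ)) {A' : C₁} {π : A ⟶ A'}
    (hπ : PreFrobenioid.IsPrimeFrobenius F₁ π) : PreFrobenioid.degFr F₂ (Ψ.functor.map π) = 1 := by
  have hP₁ := hF₁.isPreFrobenioid
  have hP₂ := hF₂.isPreFrobenioid
  by_contra hne
  -- a Frobenius partner of the same degree out of `B`
  obtain ⟨B', πB, hπB, hπBd⟩ := hF₁.ii_exists B (PreFrobenioid.degFr F₁ π)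
  have hd : PreFrobenioid.degFr F₁ π = PreFrobenioid.degFr F₁ πB := hπBd.symm
  have hδ := degFr_map_frobenius_eq_of_isPreStep hF₁ hF₂ hi₁ hi₂ Ψ hσ hπ.1 hπB hd
  have hπBp : PreFrobenioid.IsPrimeFrobenius F₁ πB := ⟨hπB, by rw [hπBd]; exact hπ.2⟩
  have hπirr : IsIrreducibleHom (Ψ.functor.map π) := (hπ.isIrreducibleHom hF₁ (hi₁ _)).map_equivalence Ψ
  have hπBirr : IsIrreducibleHom (Ψ.functor.map πB) :=
    (hπBp.isIrreducibleHom hF₁ (hi₁ _)).map_equivalence Ψ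
  -- both images are prime-Frobenius, hence of Frobenius type
  have hΨπ : PreFrobenioid.IsPrimeFrobenius F₂ (Ψ.functor.map π) :=
    (PreFrobenioid.isPrimeFrobenius_iff_degFr_ne_one_of_isIrreducibleHom F₂ hF₂ hi₂ hπirr).2 hne
  have hΨπB : PreFrobenioid.IsPrimeFrobenius F₂ (Ψ.functor.map πB) :=
    (PreFrobenioid.isPrimeFrobenius_iff_degFr_ne_one_of_isIrreducibleHom F₂ hF₂ hi₂ hπBirr).2
      (by rw [← hδ]; exact hne)
  -- the Frobenius conjugate `t` of `σ`: `π ≫ t = σ ≫ πB`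
  obtain ⟨t, ht, -⟩ := PreFrobenioid.existsUnique_frobeniusConjugate hF₁ σ hπ.1 hπB hd
  have htp : PreFrobenioid.IsPreStep F₁ t := hσ.frobeniusConjugate hF₁ ht hπ.1 hπB hd
  have htco : PreFrobenioid.IsCoAngularPreStep F₁ t :=
    ⟨PreFrobenioid.isCoAngular_of_isIsotropic_codomains F₁ t (fun Z _ => hi₁ Z), htp⟩
  -- its divisor is the `p`-th power of an irreducible element
  haveI : IsIso (PreFrobenioid.Base F₁ π) := hπ.1.2
  have hx : IsIrreducibleElt (PreFrobenioid.Div F₁ σ) :=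
    PreFrobenioid.isIrreducibleElt_div_of_isIrreducibleHom F₁ hF₁ hi₁ hσ hirr
  have hx₁ : IsIrreducibleElt (pull Φ₁ (inv (PreFrobenioid.Base F₁ π)) (PreFrobenioid.Div F₁ σ)) :=
    (isIrreducibleElt_pull_iff Φ₁ _ _).2 hx
  have htd : PreFrobenioid.Div F₁ t =
      pull Φ₁ (inv (PreFrobenioid.Base F₁ π)) (PreFrobenioid.Div F₁ σ) ^ (PreFrobenioid.degFr F₁ πB : ℕ) :=
    PreFrobenioid.div_frobeniusConjugate ht hπ.1 hπB
  have hp2 : 2 ≤ (PreFrobenioid.degFr F₁ πB : ℕ) := by rw [hπBd]; exact hπ.2.two_le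
  -- so `t = t₁ ≫ t₂` with `t₁`, `t₂` non-invertible (Def. 1.3 (iii)(d))
  obtain ⟨T₁, t₁, ht₁, ht₁d⟩ := hF₁.iii_d_under_surj A'
    (pull Φ₁ (inv (PreFrobenioid.Base F₁ π)) (PreFrobenioid.Div F₁ σ))
  obtain ⟨t₂, ht₂, ht12⟩ := hF₁.iii_d_under_full t₁ t ht₁ htco
    (by rw [ht₁d, htd]; exact dvd_pow_self _ (PNat.ne_zero _))
  have ht₁ni : ¬ IsIso t₁ := fun h => hx₁.1 (by
    rw [← ht₁d]
    haveI := h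
    exact PreFrobenioid.isIsometry_of_isIso F₁ hP₁ t₁)
  have hS : IsSharp (Φ₁.obj (op (PreFrobenioid.baseObj F₁ A'))) := (hP₁.isDivisorial _).isSharp
  haveI : IsCancelMul (Φ₁.obj (op (PreFrobenioid.baseObj F₁ A'))) :=
    isIntegral_iff_isCancelMul.1 (hP₁.isDivisorial _).isPreDivisorial.isIntegral
  have ht₂ni : ¬ IsIso t₂ := by
    intro h
    haveI := h
    have hiso : PreFrobenioid.Div F₁ t₂ = 1 := PreFrobenioid.isIsometry_of_isIso F₁ hP₁ t₂
    have e := congrArg (PreFrobenioid.Div F₁) ht12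
    rw [PreFrobenioid.div_comp, hiso, map_one, one_mul, ht₁d,
      show PreFrobenioid.degFr F₁ t₂ = 1 from ht₂.2.1, PNat.one_coe, pow_one, htd] at e
    -- `e : x₁ = x₁ ^ p` with `p ≥ 2`
    obtain ⟨k, hk⟩ : ∃ k, (PreFrobenioid.degFr F₁ πB : ℕ) = k + 1 + 1 :=
      ⟨(PreFrobenioid.degFr F₁ πB : ℕ) - 2, by omega⟩
    rw [hk, pow_succ, pow_succ] at e
    have e' : (1 : Φ₁.obj (op (PreFrobenioid.baseObj F₁ A'))) *
        pull Φ₁ (inv (PreFrobenioid.Base F₁ π)) (PreFrobenioid.Div F₁ σ) =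
        (pull Φ₁ (inv (PreFrobenioid.Base F₁ π)) (PreFrobenioid.Div F₁ σ) ^ k *
          pull Φ₁ (inv (PreFrobenioid.Base F₁ π)) (PreFrobenioid.Div F₁ σ)) *
          pull Φ₁ (inv (PreFrobenioid.Base F₁ π)) (PreFrobenioid.Div F₁ σ) := by
      rw [one_mul]; exact e
    have e'' := mul_right_cancel e'
    exact pow_ne_one_of_ne_one hS hx₁.1 (Nat.succ_ne_zero k) (by rw [pow_succ]; exact e''.symm)
  -- in `C₂`: `Ψt` is the Frobenius conjugate of the pull-back `Ψσ`, hence a pull-back …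
  have ht₂' : Ψ.functor.map π ≫ Ψ.functor.map t = Ψ.functor.map σ ≫ Ψ.functor.map πB := by
    rw [← Functor.map_comp, ht, Functor.map_comp]
  have hΨt : PreFrobenioid.IsPullbackMorphism F₂ (Ψ.functor.map t) :=
    hpb.frobeniusConjugate hF₂ ht₂' hΨπ.1 hΨπB.1 hδ
  -- … with irreducible base (an iso-conjugate of the irreducible base of `Ψσ`) …
  have hbσ : IsIrreducibleHom (PreFrobenioid.Base F₂ (Ψ.functor.map σ)) :=
    (PreFrobenioid.isIrreducibleHom_iff_of_isPullbackMorphism hF₂ hpb).1 (hirr.map_equivalence Ψ)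
  haveI : IsIso (PreFrobenioid.Base F₂ (Ψ.functor.map π)) := hΨπ.1.2
  haveI : IsIso (PreFrobenioid.Base F₂ (Ψ.functor.map πB)) := hΨπB.1.2
  have hbt : IsIrreducibleHom (PreFrobenioid.Base F₂ (Ψ.functor.map t)) := by
    refine hbσ.of_arrow_iso (asIso (PreFrobenioid.Base F₂ (Ψ.functor.map π)))
      (asIso (PreFrobenioid.Base F₂ (Ψ.functor.map πB))) ?_
    simp only [asIso_hom]
    rw [← PreFrobenioid.base_comp, ← PreFrobenioid.base_comp, ht₂']
  -- … hence irreducible; but `t = t₁ ≫ t₂` is not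
  have htirr : IsIrreducibleHom t :=
    (isIrreducibleHom_map_iff Ψ t).1 ((PreFrobenioid.isIrreducibleHom_iff_of_isPullbackMorphism hF₂ hΨt).2 hbt)
  rcases htirr.2 t₁ t₂ ht12 with h | h
  · exact ht₂ni h
  · exact ht₁ni h

/-- A non-invertible pre-step of `C₁` whose image under `Ψ` is an isometry contributes a chain of
`≥ 1` FSMI-morphisms of `D₂`: the image is a linear isometry, i.e. a pull-back morphism (isotropy),
it is an FSM-morphism (image of a co-angular pre-step, Prop. 1.11 (vii)), so its base is a
non-invertible FSM-morphism (Prop. 1.11 (vi), Remark 1.2.1), which factors by condition (a) of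
"FSMFF-type". [cite: MochizukiFrdI2008, §0 p.17] -/
theorem exists_isFSMIChain_base_map_of_isIsometry_map (hF₁ : PreFrobenioid.IsFrobenioid F₁)
    (hF₂ : PreFrobenioid.IsFrobenioid F₂) (hi₁ : ∀ A : C₁, PreFrobenioid.IsIsotropic F₁ A)
    (hi₂ : ∀ A : C₂, PreFrobenioid.IsIsotropic F₂ A) (hD₂ : IsOfFSMFFType D₂) (Ψ : C₁ ≌ C₂)
    {X Y : C₁} {s : X ⟶ Y} (hs : PreFrobenioid.IsPreStep F₁ s) (hsni : ¬ IsIso s)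
    (hiso : PreFrobenioid.IsIsometry F₂ (Ψ.functor.map s)) :
    ∃ m : ℕ, 1 ≤ m ∧ IsFSMIChain (PreFrobenioid.Base F₂ (Ψ.functor.map s)) m := by
  have hlin := isLinear_map_of_isPreStep hF₁ hF₂ hi₁ hi₂ Ψ hs
  have hpb : PreFrobenioid.IsPullbackMorphism F₂ (Ψ.functor.map s) :=
    isPullbackMorphism_of_isLinear_of_isIsometry hF₂ hi₂ hlin hiso
  have hsFSM : IsFSM s := PreFrobenioid.IsCoAngularPreStep.isFSM hF₁
    ⟨PreFrobenioid.isCoAngular_of_isIsotropic_codomains F₁ s (fun Z _ => hi₁ Z), hs⟩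
  have hb : IsFSM (PreFrobenioid.Base F₂ (Ψ.functor.map s)) :=
    (PreFrobenioid.isFSM_iff_of_isPullbackMorphism hF₂ hpb).1 (hsFSM.map_equivalence Ψ)
  have hbni : ¬ IsIso (PreFrobenioid.Base F₂ (Ψ.functor.map s)) := by
    intro h
    haveI : IsIso (Ψ.functor.map s) :=
      (PreFrobenioid.isPullbackMorphism_and_isBaseIso_iff_isIso F₂ _).1 ⟨hpb, h⟩
    exact hsni (isIso_of_fully_faithful Ψ.functor s)
  obtain ⟨m, hm⟩ := hD₂.factors _ hb hbni
  exact ⟨m, hm.pos, hm⟩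

/-- Iterating the previous fact along a co-angular pre-step `τ` out of `O₁` whose divisor is the
`(n+1)`-st power of an element `y ≠ 0` (so that `τ` is a composite of `n + 1` non-invertible
pre-steps, Def. 1.3 (iii)(d)): if `Ψτ` is an isometry, `Base(Ψτ)` is a chain of `≥ n + 1`
FSMI-morphisms of `D₂` out of `Base(Ψ O₁)`. [cite: MochizukiFrdI2008, §0 p.17] -/
theorem exists_isFSMIChain_base_map_of_div_eq_pow (hF₁ : PreFrobenioid.IsFrobenioid F₁)
    (hF₂ : PreFrobenioid.IsFrobenioid F₂) (hi₁ : ∀ A : C₁, PreFrobenioid.IsIsotropic F₁ A)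
    (hi₂ : ∀ A : C₂, PreFrobenioid.IsIsotropic F₂ A) (hD₂ : IsOfFSMFFType D₂) (Ψ : C₁ ≌ C₂)
    {O₁ : C₁} {y : Φ₁.obj (op (PreFrobenioid.baseObj F₁ O₁))} (hy : y ≠ 1) :
    ∀ (n : ℕ) {Y : C₁} (τ : O₁ ⟶ Y), PreFrobenioid.IsCoAngularPreStep F₁ τ →
      PreFrobenioid.Div F₁ τ = y ^ (n + 1) → PreFrobenioid.IsIsometry F₂ (Ψ.functor.map τ) →
        ∃ m : ℕ, n + 1 ≤ m ∧ IsFSMIChain (PreFrobenioid.Base F₂ (Ψ.functor.map τ)) m := by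
  have hP₁ := hF₁.isPreFrobenioid
  have hP₂ := hF₂.isPreFrobenioid
  have hS : IsSharp (Φ₁.obj (op (PreFrobenioid.baseObj F₁ O₁))) := (hP₁.isDivisorial _).isSharp
  haveI : IsCancelMul (Φ₁.obj (op (PreFrobenioid.baseObj F₁ O₁))) :=
    isIntegral_iff_isCancelMul.1 (hP₁.isDivisorial _).isPreDivisorial.isIntegral
  intro n
  induction n with
  | zero =>
    intro Y τ hτ hdiv hiso
    have hni : ¬ IsIso τ := fun h => by
      haveI := h
      have h1 : PreFrobenioid.Div F₁ τ = 1 := PreFrobenioid.isIsometry_of_isIso F₁ hP₁ τ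
      rw [hdiv, zero_add, pow_one] at h1
      exact hy h1
    exact exists_isFSMIChain_base_map_of_isIsometry_map hF₁ hF₂ hi₁ hi₂ hD₂ Ψ hτ.2 hni hiso
  | succ n ih =>
    intro Y τ hτ hdiv hiso
    -- `τ = τ' ≫ s` with `Div τ' = y ^ (n + 1)`
    obtain ⟨Y', τ', hτ', hτ'd⟩ := hF₁.iii_d_under_surj O₁ (y ^ (n + 1))
    obtain ⟨s, hs, hfac⟩ := hF₁.iii_d_under_full τ' τ hτ' hτ
      (by rw [hτ'd, hdiv]; exact pow_dvd_pow y (Nat.le_succ _))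
    have hiso' : PreFrobenioid.IsIsometry F₂ (Ψ.functor.map τ' ≫ Ψ.functor.map s) := by
      rw [← Functor.map_comp, hfac]; exact hiso
    obtain ⟨hisos, hisoτ'⟩ := PreFrobenioid.isIsometry_factors F₂ hP₂ hiso'
    obtain ⟨m₁, hm₁, hc₁⟩ := ih τ' hτ' hτ'd hisoτ'
    -- `s` is not invertible: its divisor pulls back to `y`
    have hsni : ¬ IsIso s := by
      intro h
      haveI := h
      have h1 : PreFrobenioid.Div F₁ s = 1 := PreFrobenioid.isIsometry_of_isIso F₁ hP₁ s
      have e := congrArg (PreFrobenioid.Div F₁) hfac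
      rw [PreFrobenioid.div_comp, h1, map_one, one_mul, hτ'd,
        show PreFrobenioid.degFr F₁ s = 1 from hs.2.1, PNat.one_coe, pow_one, hdiv, pow_succ y (n + 1)] at e
      have e' : (1 : Φ₁.obj (op (PreFrobenioid.baseObj F₁ O₁))) * y ^ (n + 1) = y * y ^ (n + 1) := by
        rw [one_mul, mul_comm]; exact e
      exact hy (mul_right_cancel e').symm
    obtain ⟨m₂, hm₂, hc₂⟩ :=
      exists_isFSMIChain_base_map_of_isIsometry_map hF₁ hF₂ hi₁ hi₂ hD₂ Ψ hs.2 hsni hisos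
    refine ⟨m₂ + m₁, by omega, ?_⟩
    rw [← hfac, Functor.map_comp, PreFrobenioid.base_comp]
    exact hc₁.concat hc₂

/-- **[FrdI] Thm. 3.4 (ii), pre-steps — ISOTROPIC CORE over bases of FSMFF-type AS PRINTED (2008).**
For Frobenioids `C₁`, `C₂` of isotropic type, `D₂` of FSMFF-type in the printed sense (conditions
(a), (b) of §0 p. 17; `D₁` arbitrary) and an equivalence `Ψ : C₁ ⥲ C₂`, `Ψ` maps every irreducible
pre-step of `C₁` to a pre-step of `C₂`. (Route (W1)–(W4) of the module docstring; not the printed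
route through Prop. 1.14 (iii).) [cite: MochizukiFrdI2008, Thm. 3.4 (ii) p.62] -/
theorem isPreStep_map_of_isIrreducible_of_isOfFSMFFType (hF₁ : PreFrobenioid.IsFrobenioid F₁)
    (hF₂ : PreFrobenioid.IsFrobenioid F₂) (hist₁ : PreFrobenioid.IsOfIsotropicType F₁)
    (hist₂ : PreFrobenioid.IsOfIsotropicType F₂) (hD₂ : IsOfFSMFFType D₂) (Ψ : C₁ ≌ C₂)
    {A B : C₁} {σ : A ⟶ B} (hσ : PreFrobenioid.IsPreStep F₁ σ) (hirr : IsIrreducibleHom σ) :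
    PreFrobenioid.IsPreStep F₂ (Ψ.functor.map σ) := by
  have hP₁ := hF₁.isPreFrobenioid
  have hP₂ := hF₂.isPreFrobenioid
  have hi₁ : ∀ X : C₁, PreFrobenioid.IsIsotropic F₁ X := hist₁
  have hi₂ : ∀ X : C₂, PreFrobenioid.IsIsotropic F₂ X := hist₂
  have hmon₂ := hP₂.isMonoidOn
  by_contra hnot
  -- Step 0: `Ψσ` is a pull-back morphism (Prop. 1.14 (i), Lemma A)
  have hΨirr : IsIrreducibleHom (Ψ.functor.map σ) := hirr.map_equivalence Ψ
  have hstep : PreFrobenioid.IsStep F₁ σ := ⟨hσ, hirr.1⟩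
  have hpb : PreFrobenioid.IsPullbackMorphism F₂ (Ψ.functor.map σ) := by
    rcases PreFrobenioid.trichotomy_of_isIrreducibleHom F₂ hF₂ hi₂ hΨirr with h | ⟨h, -⟩ | ⟨h, -⟩
    · exact (not_isPrimeFrobenius_map_of_isStep hF₁ hF₂ hi₁ hi₂ Ψ hstep h).elim
    · exact (hnot h.1).elim
    · exact h
  have hx : IsIrreducibleElt (PreFrobenioid.Div F₁ σ) :=
    PreFrobenioid.isIrreducibleElt_div_of_isIrreducibleHom F₁ hF₁ hi₁ hσ hirr
  -- Step 1: a Frobenius-trivial `O` over `Base A` and a span of pre-steps `O ← Z → A`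
  obtain ⟨O, ⟨ζ, hζ⟩, ⟨ι⟩⟩ := hF₁.i_a (PreFrobenioid.baseObj F₁ A)
  obtain ⟨Z, zO, zA, hzO, hzA, -⟩ := hF₁.i_b O A ι
  -- an irreducible element `x'` of `Φ₁(Base O)` and a step `σ₀ : O → O₁` of divisor `x'`
  have hx' : IsIrreducibleElt (pull Φ₁ ι.hom (PreFrobenioid.Div F₁ σ)) :=
    (isIrreducibleElt_pull_iff Φ₁ ι.hom _).2 hx
  obtain ⟨O₁, σ₀, hσ₀, hσ₀d⟩ := hF₁.iii_d_under_surj O (pull Φ₁ ι.hom (PreFrobenioid.Div F₁ σ))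
  have hσ₀step : PreFrobenioid.IsStep F₁ σ₀ := ⟨hσ₀.2, fun h => hx'.1 (by
    rw [← hσ₀d]
    haveI := h
    exact PreFrobenioid.isIsometry_of_isIso F₁ hP₁ σ₀)⟩
  have hσ₀irr : IsIrreducibleHom σ₀ :=
    PreFrobenioid.isIrreducibleHom_of_isStep F₁ hP₁ hi₁ hσ₀step (by rw [hσ₀d]; exact hx')
  haveI : IsIso (PreFrobenioid.Base F₁ σ₀) := hσ₀.2.2
  -- the transport `y` of `x'` to `Φ₁(Base O₁)`
  have hy : pull Φ₁ (inv (PreFrobenioid.Base F₁ σ₀)) (pull Φ₁ ι.hom (PreFrobenioid.Div F₁ σ)) ≠ 1 :=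
    ((isIrreducibleElt_pull_iff Φ₁ _ _).2 hx').1
  -- Step 2: the bound of condition (b) at `Base (Ψ O₁)`, and a large prime
  obtain ⟨N, hN⟩ := hD₂.bounded (PreFrobenioid.baseObj F₂ (Ψ.functor.obj O₁))
  obtain ⟨p, hpN, hp⟩ := Nat.exists_infinite_primes (N + 3)
  let pp : ℕ+ := ⟨p, hp.pos⟩
  have hppc : ((pp : ℕ+) : ℕ) = p := rfl
  -- Frobenius morphisms of degree `p` out of `O` (the Frobenius-trivial structure), `O₁`, `A`, `Z`
  obtain ⟨hζd, hζb, hζF⟩ := hζ pp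
  set zp : O ⟶ O := ζ pp with hzpdef
  obtain ⟨P, π₁, hπ₁, hπ₁d⟩ := hF₁.ii_exists O₁ pp
  obtain ⟨A', πA, hπA, hπAd⟩ := hF₁.ii_exists A pp
  obtain ⟨Z', πZ, hπZ, hπZd⟩ := hF₁.ii_exists Z pp
  have hπAp : PreFrobenioid.IsPrimeFrobenius F₁ πA := ⟨hπA, by rw [hπAd, hppc]; exact hp⟩
  have hzpp : PreFrobenioid.IsPrimeFrobenius F₁ zp := ⟨hζF, by rw [hζd, hppc]; exact hp⟩
  have hπ₁p : PreFrobenioid.IsPrimeFrobenius F₁ π₁ := ⟨hπ₁, by rw [hπ₁d, hppc]; exact hp⟩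
  -- Step 3 (W2, W1): the images of these Frobenius morphisms have Frobenius degree `1` …
  have hA1 : PreFrobenioid.degFr F₂ (Ψ.functor.map πA) = 1 :=
    degFr_map_eq_one_of_isPullbackMorphism_map hF₁ hF₂ hi₁ hi₂ Ψ hσ hirr hpb hπAp
  have hZ1 : PreFrobenioid.degFr F₂ (Ψ.functor.map πZ) = 1 := by
    rw [degFr_map_frobenius_eq_of_isPreStep hF₁ hF₂ hi₁ hi₂ Ψ hzA hπZ hπA (hπZd.trans hπAd.symm), hA1]
  have hO1 : PreFrobenioid.degFr F₂ (Ψ.functor.map zp) = 1 := by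
    rw [← degFr_map_frobenius_eq_of_isPreStep hF₁ hF₂ hi₁ hi₂ Ψ hzO hπZ hζF (hπZd.trans hζd.symm), hZ1]
  have hO₁1 : PreFrobenioid.degFr F₂ (Ψ.functor.map π₁) = 1 := by
    rw [← degFr_map_frobenius_eq_of_isPreStep hF₁ hF₂ hi₁ hi₂ Ψ hσ₀.2 hζF hπ₁ (hζd.trans hπ₁d.symm), hO1]
  -- … so `Ψζ_p`, `Ψπ₁` are pull-back morphisms: isometric and linear (W3)
  obtain ⟨hζpb, -⟩ := isPullbackMorphism_map_of_isPrimeFrobenius_of_degFr_eq_one hF₁ hF₂ hi₁ hi₂ Ψ hzpp hO1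
  obtain ⟨hπ₁pb, -⟩ := isPullbackMorphism_map_of_isPrimeFrobenius_of_degFr_eq_one hF₁ hF₂ hi₁ hi₂ Ψ hπ₁p hO₁1
  have hζiso : PreFrobenioid.Div F₂ (Ψ.functor.map zp) = 1 := (hF₂.iv_b _ hζpb).1.2
  have hπ₁iso : PreFrobenioid.Div F₂ (Ψ.functor.map π₁) = 1 := (hF₂.iv_b _ hπ₁pb).1.2
  have hπ₁lin : PreFrobenioid.degFr F₂ (Ψ.functor.map π₁) = 1 := (hF₂.iv_b _ hπ₁pb).2
  -- Step 4 (W4): `c_p : O → O_p` of divisor `x' ^ p`, `σ₀ ≫ τ = c_p`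
  obtain ⟨Op, cp, hcp, hcpd⟩ := hF₁.iii_d_under_surj O (pull Φ₁ ι.hom (PreFrobenioid.Div F₁ σ) ^ p)
  obtain ⟨τ, hτ, hστ⟩ := hF₁.iii_d_under_full σ₀ cp hσ₀ hcp
    (by rw [hσ₀d, hcpd]; exact dvd_pow_self _ hp.ne_zero)
  -- divisor of `τ`
  have hS : IsSharp (Φ₁.obj (op (PreFrobenioid.baseObj F₁ O))) := (hP₁.isDivisorial _).isSharp
  haveI : IsCancelMul (Φ₁.obj (op (PreFrobenioid.baseObj F₁ O))) :=
    isIntegral_iff_isCancelMul.1 (hP₁.isDivisorial _).isPreDivisorial.isIntegral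
  obtain ⟨k, hk⟩ : ∃ k, p = k + 2 := ⟨p - 2, by omega⟩
  have hτd : PreFrobenioid.Div F₁ τ =
      pull Φ₁ (inv (PreFrobenioid.Base F₁ σ₀)) (pull Φ₁ ι.hom (PreFrobenioid.Div F₁ σ)) ^ (k + 1) := by
    have e := congrArg (PreFrobenioid.Div F₁) hστ
    rw [PreFrobenioid.div_comp, hσ₀d, show PreFrobenioid.degFr F₁ τ = 1 from hτ.2.1, PNat.one_coe,
      pow_one, hcpd, hk, pow_succ] at e
    have e' := mul_right_cancel e
    rw [← map_pow, ← e', ← pull_comp, IsIso.inv_hom_id, pull_id]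
  -- the Frobenius conjugate `t` of `σ₀` by `ζ_p`, `π₁`: `ζ_p ≫ t = σ₀ ≫ π₁`, `Div t = x' ^ p`
  obtain ⟨t, ht, -⟩ := PreFrobenioid.existsUnique_frobeniusConjugate hF₁ σ₀ hζF hπ₁ (hζd.trans hπ₁d.symm)
  have htp : PreFrobenioid.IsPreStep F₁ t := hσ₀.2.frobeniusConjugate hF₁ ht hζF hπ₁ (hζd.trans hπ₁d.symm)
  have htco : PreFrobenioid.IsCoAngularPreStep F₁ t :=
    ⟨PreFrobenioid.isCoAngular_of_isIsotropic_codomains F₁ t (fun W _ => hi₁ W), htp⟩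
  have htd : PreFrobenioid.Div F₁ t = pull Φ₁ ι.hom (PreFrobenioid.Div F₁ σ) ^ p := by
    have e := congrArg (PreFrobenioid.Div F₁) ht
    rw [PreFrobenioid.div_comp, PreFrobenioid.div_comp, show PreFrobenioid.Base F₁ zp = 𝟙 _ from hζb,
      pull_id, show PreFrobenioid.Div F₁ zp = 1 from hζF.1.2, one_pow, mul_one,
      show PreFrobenioid.Div F₁ π₁ = 1 from hπ₁.1.2, map_one, one_mul, hσ₀d, hπ₁d, hppc] at e
    exact e
  obtain ⟨e, he, hcpe⟩ := hF₁.iii_d_under_full cp t hcp htco (by rw [hcpd, htd])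
  -- the identity `ζ_p ≫ σ₀ ≫ (τ ≫ e) = σ₀ ≫ π₁`, pushed to `C₂`
  have hsq : zp ≫ σ₀ ≫ τ ≫ e = σ₀ ≫ π₁ := by
    rw [← Category.assoc σ₀ τ e, hστ, hcpe, ht]
  have hsq₂ : Ψ.functor.map zp ≫ Ψ.functor.map σ₀ ≫ Ψ.functor.map (τ ≫ e) =
      Ψ.functor.map σ₀ ≫ Ψ.functor.map π₁ := by
    rw [← Functor.map_comp, ← Functor.map_comp, hsq, Functor.map_comp]
  have hρp : PreFrobenioid.IsPreStep F₁ (τ ≫ e) := PreFrobenioid.IsPreStep.comp F₁ hτ.2 he.2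
  have hρlin : PreFrobenioid.degFr F₂ (Ψ.functor.map (τ ≫ e)) = 1 :=
    isLinear_map_of_isPreStep hF₁ hF₂ hi₁ hi₂ Ψ hρp
  have hσ₀lin : PreFrobenioid.degFr F₂ (Ψ.functor.map σ₀) = 1 :=
    isLinear_map_of_isPreStep hF₁ hF₂ hi₁ hi₂ Ψ hσ₀.2
  -- reading `Div` in `C₂`
  have hE := congrArg (PreFrobenioid.Div F₂) hsq₂
  rw [PreFrobenioid.div_comp, PreFrobenioid.div_comp, PreFrobenioid.div_comp, hζiso, one_pow, mul_one,
    hρlin, PNat.one_coe, pow_one, hπ₁iso, map_one, one_mul, hπ₁lin, PNat.one_coe, pow_one, map_mul] at hE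
  -- hE : g^*(σ₀^* Div Ψ(τ ≫ e)) * g^*(Div Ψσ₀) = Div Ψσ₀
  have hρiso : PreFrobenioid.Div F₂ (Ψ.functor.map (τ ≫ e)) = 1 := by
    by_contra hne
    have ha : pull Φ₂ (PreFrobenioid.Base F₂ (Ψ.functor.map zp))
        (pull Φ₂ (PreFrobenioid.Base F₂ (Ψ.functor.map σ₀)) (PreFrobenioid.Div F₂ (Ψ.functor.map (τ ≫ e)))) ≠ 1 :=
      pull_ne_one Φ₂ hmon₂ _ (pull_ne_one Φ₂ hmon₂ _ hne)
    by_cases hY : PreFrobenioid.Div F₂ (Ψ.functor.map σ₀) = 1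
    · rw [hY, map_one, mul_one] at hE
      exact ha hE
    · -- `Div Ψσ₀` is irreducible: `Ψσ₀` is an irreducible linear morphism with non-trivial divisor
      have hYirr : IsIrreducibleElt (PreFrobenioid.Div F₂ (Ψ.functor.map σ₀)) := by
        rcases PreFrobenioid.trichotomy_of_isIrreducibleHom F₂ hF₂ hi₂ (hσ₀irr.map_equivalence Ψ) with
            h | ⟨-, h⟩ | ⟨h, -⟩
        · have h2 := h.2
          rw [hσ₀lin, PNat.one_coe] at h2
          exact (Nat.not_prime_one h2).elim
        · exact h
        · exact (hY (hF₂.iv_b _ h).1.2).elim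
      rcases hYirr.2 _ _ hE.symm with h | h
      · exact ha h
      · exact pull_ne_one Φ₂ hmon₂ _ hY h
  -- hence `Ψτ` is an isometry, and `Base(Ψτ)` is a chain of `≥ p - 1` FSMI-morphisms out of `Base(Ψ O₁)`
  have hτiso : PreFrobenioid.IsIsometry F₂ (Ψ.functor.map τ) := by
    have h : PreFrobenioid.IsIsometry F₂ (Ψ.functor.map τ ≫ Ψ.functor.map e) := by
      rw [← Functor.map_comp]; exact hρiso
    exact (PreFrobenioid.isIsometry_factors F₂ hP₂ h).2
  obtain ⟨m, hm, hchain⟩ := exists_isFSMIChain_base_map_of_div_eq_pow hF₁ hF₂ hi₁ hi₂ hD₂ Ψ hy k τ hτ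
    hτd hτiso
  have := hN _ m hchain
  omega

/-- **The 2008 twin of the one revised-(b)-dependent input of `EquivalencePreStepsFSMFF2024.lean`**:
for Frobenioids of isotropic type with `D₂` of FSMFF-type AS PRINTED, `Ψ⁻¹` carries every
irreducible NON-pre-step of `C₂` to a NON-pre-step of `C₁`. (If `Ψ⁻¹β` were a pre-step — an
irreducible one — the core would make `Ψ Ψ⁻¹ β ≅ β` a pre-step.) With this in place of
`FrdI.not_isPreStep_inverse_map_of_isIrreducibleHom`, the derivation of Thm. 3.4 (ii) for all
pre-steps, co-angular pre-steps and group-like objects (Prop. 1.14 (ii) in `C₁` and `C₂`,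
transport of mid-adjointness) and the quasi-isotropic reduction go through verbatim.
[cite: MochizukiFrdI2008, Thm. 3.4 (ii) p.63] -/
theorem not_isPreStep_inverse_map_of_isIrreducibleHom_of_isOfFSMFFType
    (hF₁ : PreFrobenioid.IsFrobenioid F₁) (hF₂ : PreFrobenioid.IsFrobenioid F₂)
    (hist₁ : PreFrobenioid.IsOfIsotropicType F₁) (hist₂ : PreFrobenioid.IsOfIsotropicType F₂)
    (hD₂ : IsOfFSMFFType D₂) (Ψ : C₁ ≌ C₂) {X Y : C₂} {β : X ⟶ Y} (hβ : IsIrreducibleHom β)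
    (hnps : ¬ PreFrobenioid.IsPreStep F₂ β) : ¬ PreFrobenioid.IsPreStep F₁ (Ψ.inverse.map β) := by
  intro hρ
  have hD := hF₂.isPreFrobenioid.isTotallyEpimorphic_base
  have hirr : IsIrreducibleHom (Ψ.inverse.map β) := hβ.map_equivalence Ψ.symm
  have h := isPreStep_map_of_isIrreducible_of_isOfFSMFFType hF₁ hF₂ hist₁ hist₂ hD₂ Ψ hρ hirr
  rw [Ψ.fun_inv_map] at h
  exact hnps (PreFrobenioid.isPreStep_factors F₂ hD (PreFrobenioid.isPreStep_factors F₂ hD h).1).2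

end Two

end FrdI

end Literature.AlgebraicGeometry.Frobenioids
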